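import Summits.Ventures.QEC.Census.BB.A1s_n108_k4_02da032b.Cert
import Literature.InformationTheory.QuantumCodes.TwoBlockConnectedComponents
import Literature.InformationTheory.QuantumCodes.TwoBlockToricLayout
import Literature.InformationTheory.QuantumCodes.TwoBlockWheelComponents
import HarnessLib
import HarnessLib.Audit.Tags
import Summits.Ventures.QEC.Census.BB.A1s_n124_k10_6d3fc82a.Cert
import Summits.Ventures.QEC.Census.BB.A1s_n72_k4_d527f4c2.Cert
import Summits.Ventures.QEC.Census.BB.A1s_n72_k8_ec9823fb.Cert

/-!
# The δ-lane A.1 census rows (typed codes `<Row>.code : BB.Code ℓ m` of `Census/BB/<Row>/Cert.lean`): LAYOUT columns in the kernel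
# — Bravyi et al. 2024 §5 Lemma 3 (connected), Lemma 4 (toric layout, where applicable), Lemma 2 minus planarity (wheel layers);
# batch 1 of 2 (4 rows)

Rows: `A1s_n108_k4_02da032b`, `A1s_n124_k10_6d3fc82a`, `A1s_n72_k4_d527f4c2`, `A1s_n72_k8_ec9823fb`. Per row (namespace `Summit.Ventures.QEC.Census.<Row>`):
`code_tannerGraph_connected` (`BB.Code.tannerGraph_connected_of_unit_mem` with explicit multiples of exponent differences);
`code_hasToricLayoutWith μ λ` / `code_hasToricLayout` (`BB.Code.hasToricLayoutWith_of_exponents`) when two exponent differences of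
complementary orders generate `ℤ_ℓ × ℤ_m` (Lemma 4's sufficient condition; omitted otherwise); `code_wheel_layers`
(`BB.Code.exists_wheel_layers`: two edge-disjoint layers of wheel graphs `prismGraph 2·ord(A₃A₂ᵀ)` / `prismGraph 2·ord(B₂B₁ᵀ)`;
planarity itself is not asserted). All small arithmetic facts `decide`d on the literal data (tools/conn_cert.py finds the witnesses).
These rows already carry `BB.HasParams code n k d` in their `Distance.lean`. Companion of `Census/BB/Layout.lean` / `WheelLayers.lean`
(the Table-3 codes) and of the bridge files `Census/BB/*QC.lean`. KERNEL; axioms standard; no `native_decide`.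
-/

namespace Summit.Ventures.QEC.Census.A1s_n108_k4_02da032b

open SimpleGraph Literature.InformationTheory.QuantumCodes

set_option maxRecDepth 100000 in
/-- **The Tanner graph of `A1s_n108_k4_02da032b.code` is connected** (BCGMRY24 Lemma 3: `x`, `y` are explicit combinations of exponent differences inside `A`
or inside `B`). Census column «connected» = true, KERNEL. -/
theorem code_tannerGraph_connected : A1s_n108_k4_02da032b.code.css.tannerGraph.Connected := by
  refine A1s_n108_k4_02da032b.code.tannerGraph_connected_of_unit_mem (fun h => absurd (congrFun h ((0 : Fin 2), (1 : Fin 27))) (by decide))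
    (fun h => absurd (congrFun h ((0 : Fin 2), (0 : Fin 27))) (by decide)) ?_ ?_
  · have e : (((1 : Fin 2), (0 : Fin 27)) : BB.Mono 2 27) = (27 : ℕ) • (((0 : Fin 2), (1 : Fin 27)) - (1, 0)) := by decide
    rw [e]
    exact (AddSubgroup.nsmul_mem _ (A1s_n108_k4_02da032b.code.sub_mem_expDiffSubgroup_A (by decide) (by decide)) 27)
  · have e : (((0 : Fin 2), (1 : Fin 27)) : BB.Mono 2 27) = (5 : ℕ) • (((0 : Fin 2), (1 : Fin 27)) - (0, 17)) := by decide
    rw [e]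
    exact (AddSubgroup.nsmul_mem _ (A1s_n108_k4_02da032b.code.sub_mem_expDiffSubgroup_A (by decide) (by decide)) 5)


set_option maxRecDepth 100000 in
/-- **`A1s_n108_k4_02da032b.code`**: Tanner graph = edge-disjoint union of two layers whose components are wheel graphs `prismGraph 108` (`A₃A₂ᵀ` of order
`54`) and `prismGraph 54` (`B₂B₁ᵀ` of order `27`) — BCGMRY24 Lemma 2 minus planarity (`BB.Code.exists_wheel_layers`). KERNEL. -/
theorem code_wheel_layers :
    ∃ ΓA ΓB : SimpleGraph ((BB.Mono 2 27 ⊕ BB.Mono 2 27) ⊕ (BB.Mono 2 27 ⊕ BB.Mono 2 27)),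
    A1s_n108_k4_02da032b.code.css.tannerGraph = ΓA ⊔ ΓB ∧ Disjoint ΓA ΓB ∧
    (∀ K : ΓA.ConnectedComponent, Nonempty (K.toSimpleGraph ≃g prismGraph 108)) ∧
    (∀ K : ΓB.ConnectedComponent, Nonempty (K.toSimpleGraph ≃g prismGraph 54)) := by
  have hA : ∀ g : BB.Mono 2 27, A1s_n108_k4_02da032b.code.A g ≠ 0 ↔ g = ((0 : Fin 2), (1 : Fin 27)) ∨ g = ((0 : Fin 2), (17 : Fin 27)) ∨ g = ((1 : Fin 2), (0 : Fin 27)) := by decide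
  have hB : ∀ g : BB.Mono 2 27, A1s_n108_k4_02da032b.code.B g ≠ 0 ↔ g = ((0 : Fin 2), (0 : Fin 27)) ∨ g = ((0 : Fin 2), (2 : Fin 27)) ∨ g = ((0 : Fin 2), (13 : Fin 27)) := by decide
  have h := A1s_n108_k4_02da032b.code.exists_wheel_layers (g₁ := ((0 : Fin 2), (1 : Fin 27))) (g₂ := ((0 : Fin 2), (17 : Fin 27))) (g₃ := ((1 : Fin 2), (0 : Fin 27))) (h₁ := ((0 : Fin 2), (0 : Fin 27)))
    (h₂ := ((0 : Fin 2), (2 : Fin 27))) (h₃ := ((0 : Fin 2), (13 : Fin 27))) (by decide) (by decide) (by decide) (by decide) (by decide) (by decide) hA hB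
  have e1 : addOrderOf (((1 : Fin 2), (0 : Fin 27)) - (0, 17)) = 54 := (addOrderOf_eq_iff (by norm_num)).mpr (by decide)
  have e2 : addOrderOf (((0 : Fin 2), (2 : Fin 27)) - (0, 0)) = 27 := (addOrderOf_eq_iff (by norm_num)).mpr (by decide)
  rw [e1, e2] at h
  exact h

end Summit.Ventures.QEC.Census.A1s_n108_k4_02da032b

namespace Summit.Ventures.QEC.Census.A1s_n124_k10_6d3fc82a

open SimpleGraph Literature.InformationTheory.QuantumCodes

set_option maxRecDepth 100000 in
/-- **The Tanner graph of `A1s_n124_k10_6d3fc82a.code` is connected** (BCGMRY24 Lemma 3: `x`, `y` are explicit combinations of exponent differences inside `A`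
or inside `B`). Census column «connected» = true, KERNEL. -/
theorem code_tannerGraph_connected : A1s_n124_k10_6d3fc82a.code.css.tannerGraph.Connected := by
  refine A1s_n124_k10_6d3fc82a.code.tannerGraph_connected_of_unit_mem (fun h => absurd (congrFun h ((0 : Fin 2), (1 : Fin 31))) (by decide))
    (fun h => absurd (congrFun h ((0 : Fin 2), (3 : Fin 31))) (by decide)) ?_ ?_
  · have e : (((1 : Fin 2), (0 : Fin 31)) : BB.Mono 2 31) = (31 : ℕ) • (((0 : Fin 2), (1 : Fin 31)) - (1, 0)) := by decide
    rw [e]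
    exact (AddSubgroup.nsmul_mem _ (A1s_n124_k10_6d3fc82a.code.sub_mem_expDiffSubgroup_A (by decide) (by decide)) 31)
  · have e : (((0 : Fin 2), (1 : Fin 31)) : BB.Mono 2 31) = (18 : ℕ) • (((0 : Fin 2), (1 : Fin 31)) - (0, 13)) := by decide
    rw [e]
    exact (AddSubgroup.nsmul_mem _ (A1s_n124_k10_6d3fc82a.code.sub_mem_expDiffSubgroup_A (by decide) (by decide)) 18)


set_option maxRecDepth 100000 in
/-- **`A1s_n124_k10_6d3fc82a.code`**: Tanner graph = edge-disjoint union of two layers whose components are wheel graphs `prismGraph 124` (`A₃A₂ᵀ` of order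
`62`) and `prismGraph 62` (`B₂B₁ᵀ` of order `31`) — BCGMRY24 Lemma 2 minus planarity (`BB.Code.exists_wheel_layers`). KERNEL. -/
theorem code_wheel_layers :
    ∃ ΓA ΓB : SimpleGraph ((BB.Mono 2 31 ⊕ BB.Mono 2 31) ⊕ (BB.Mono 2 31 ⊕ BB.Mono 2 31)),
    A1s_n124_k10_6d3fc82a.code.css.tannerGraph = ΓA ⊔ ΓB ∧ Disjoint ΓA ΓB ∧
    (∀ K : ΓA.ConnectedComponent, Nonempty (K.toSimpleGraph ≃g prismGraph 124)) ∧
    (∀ K : ΓB.ConnectedComponent, Nonempty (K.toSimpleGraph ≃g prismGraph 62)) := by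
  have hA : ∀ g : BB.Mono 2 31, A1s_n124_k10_6d3fc82a.code.A g ≠ 0 ↔ g = ((0 : Fin 2), (1 : Fin 31)) ∨ g = ((0 : Fin 2), (13 : Fin 31)) ∨ g = ((1 : Fin 2), (0 : Fin 31)) := by decide
  have hB : ∀ g : BB.Mono 2 31, A1s_n124_k10_6d3fc82a.code.B g ≠ 0 ↔ g = ((0 : Fin 2), (3 : Fin 31)) ∨ g = ((0 : Fin 2), (23 : Fin 31)) ∨ g = ((1 : Fin 2), (0 : Fin 31)) := by decide
  have h := A1s_n124_k10_6d3fc82a.code.exists_wheel_layers (g₁ := ((0 : Fin 2), (1 : Fin 31))) (g₂ := ((0 : Fin 2), (13 : Fin 31))) (g₃ := ((1 : Fin 2), (0 : Fin 31))) (h₁ := ((0 : Fin 2), (3 : Fin 31)))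
    (h₂ := ((0 : Fin 2), (23 : Fin 31))) (h₃ := ((1 : Fin 2), (0 : Fin 31))) (by decide) (by decide) (by decide) (by decide) (by decide) (by decide) hA hB
  have e1 : addOrderOf (((1 : Fin 2), (0 : Fin 31)) - (0, 13)) = 62 := (addOrderOf_eq_iff (by norm_num)).mpr (by decide)
  have e2 : addOrderOf (((0 : Fin 2), (23 : Fin 31)) - (0, 3)) = 31 := (addOrderOf_eq_iff (by norm_num)).mpr (by decide)
  rw [e1, e2] at h
  exact h

end Summit.Ventures.QEC.Census.A1s_n124_k10_6d3fc82a

namespace Summit.Ventures.QEC.Census.A1s_n72_k4_d527f4c2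

open SimpleGraph Literature.InformationTheory.QuantumCodes

set_option maxRecDepth 100000 in
/-- **The Tanner graph of `A1s_n72_k4_d527f4c2.code` is connected** (BCGMRY24 Lemma 3: `x`, `y` are explicit combinations of exponent differences inside `A`
or inside `B`). Census column «connected» = true, KERNEL. -/
theorem code_tannerGraph_connected : A1s_n72_k4_d527f4c2.code.css.tannerGraph.Connected := by
  refine A1s_n72_k4_d527f4c2.code.tannerGraph_connected_of_unit_mem (fun h => absurd (congrFun h ((0 : Fin 4), (1 : Fin 9))) (by decide))
    (fun h => absurd (congrFun h ((0 : Fin 4), (5 : Fin 9))) (by decide)) ?_ ?_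
  · have e : (((1 : Fin 4), (0 : Fin 9)) : BB.Mono 4 9) = (9 : ℕ) • (((0 : Fin 4), (1 : Fin 9)) - (3, 0)) := by decide
    rw [e]
    exact (AddSubgroup.nsmul_mem _ (A1s_n72_k4_d527f4c2.code.sub_mem_expDiffSubgroup_A (by decide) (by decide)) 9)
  · have e : (((0 : Fin 4), (1 : Fin 9)) : BB.Mono 4 9) = (2 : ℕ) • (((0 : Fin 4), (1 : Fin 9)) - (0, 5)) := by decide
    rw [e]
    exact (AddSubgroup.nsmul_mem _ (A1s_n72_k4_d527f4c2.code.sub_mem_expDiffSubgroup_A (by decide) (by decide)) 2)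


set_option maxRecDepth 100000 in
/-- **`A1s_n72_k4_d527f4c2.code`**: Tanner graph = edge-disjoint union of two layers whose components are wheel graphs `prismGraph 72` (`A₃A₂ᵀ` of order
`36`) and `prismGraph 18` (`B₂B₁ᵀ` of order `9`) — BCGMRY24 Lemma 2 minus planarity (`BB.Code.exists_wheel_layers`). KERNEL. -/
theorem code_wheel_layers :
    ∃ ΓA ΓB : SimpleGraph ((BB.Mono 4 9 ⊕ BB.Mono 4 9) ⊕ (BB.Mono 4 9 ⊕ BB.Mono 4 9)),
    A1s_n72_k4_d527f4c2.code.css.tannerGraph = ΓA ⊔ ΓB ∧ Disjoint ΓA ΓB ∧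
    (∀ K : ΓA.ConnectedComponent, Nonempty (K.toSimpleGraph ≃g prismGraph 72)) ∧
    (∀ K : ΓB.ConnectedComponent, Nonempty (K.toSimpleGraph ≃g prismGraph 18)) := by
  have hA : ∀ g : BB.Mono 4 9, A1s_n72_k4_d527f4c2.code.A g ≠ 0 ↔ g = ((0 : Fin 4), (1 : Fin 9)) ∨ g = ((0 : Fin 4), (5 : Fin 9)) ∨ g = ((3 : Fin 4), (0 : Fin 9)) := by decide
  have hB : ∀ g : BB.Mono 4 9, A1s_n72_k4_d527f4c2.code.B g ≠ 0 ↔ g = ((0 : Fin 4), (5 : Fin 9)) ∨ g = ((0 : Fin 4), (7 : Fin 9)) ∨ g = ((1 : Fin 4), (0 : Fin 9)) := by decide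
  have h := A1s_n72_k4_d527f4c2.code.exists_wheel_layers (g₁ := ((0 : Fin 4), (1 : Fin 9))) (g₂ := ((0 : Fin 4), (5 : Fin 9))) (g₃ := ((3 : Fin 4), (0 : Fin 9))) (h₁ := ((0 : Fin 4), (5 : Fin 9)))
    (h₂ := ((0 : Fin 4), (7 : Fin 9))) (h₃ := ((1 : Fin 4), (0 : Fin 9))) (by decide) (by decide) (by decide) (by decide) (by decide) (by decide) hA hB
  have e1 : addOrderOf (((3 : Fin 4), (0 : Fin 9)) - (0, 5)) = 36 := (addOrderOf_eq_iff (by norm_num)).mpr (by decide)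
  have e2 : addOrderOf (((0 : Fin 4), (7 : Fin 9)) - (0, 5)) = 9 := (addOrderOf_eq_iff (by norm_num)).mpr (by decide)
  rw [e1, e2] at h
  exact h

end Summit.Ventures.QEC.Census.A1s_n72_k4_d527f4c2

namespace Summit.Ventures.QEC.Census.A1s_n72_k8_ec9823fb

open SimpleGraph Literature.InformationTheory.QuantumCodes

set_option maxRecDepth 100000 in
/-- **The Tanner graph of `A1s_n72_k8_ec9823fb.code` is connected** (BCGMRY24 Lemma 3: `x`, `y` are explicit combinations of exponent differences inside `A`
or inside `B`). Census column «connected» = true, KERNEL. -/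
theorem code_tannerGraph_connected : A1s_n72_k8_ec9823fb.code.css.tannerGraph.Connected := by
  refine A1s_n72_k8_ec9823fb.code.tannerGraph_connected_of_unit_mem (fun h => absurd (congrFun h ((0 : Fin 3), (0 : Fin 12))) (by decide))
    (fun h => absurd (congrFun h ((0 : Fin 3), (9 : Fin 12))) (by decide)) ?_ ?_
  · have e : (((1 : Fin 3), (0 : Fin 12)) : BB.Mono 3 12) = (8 : ℕ) • (((0 : Fin 3), (9 : Fin 12)) - (1, 0)) := by decide
    rw [e]
    exact (AddSubgroup.nsmul_mem _ (A1s_n72_k8_ec9823fb.code.sub_mem_expDiffSubgroup_B (by decide) (by decide)) 8)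
  · have e : (((0 : Fin 3), (1 : Fin 12)) : BB.Mono 3 12) = (11 : ℕ) • (((0 : Fin 3), (0 : Fin 12)) - (0, 1)) := by decide
    rw [e]
    exact (AddSubgroup.nsmul_mem _ (A1s_n72_k8_ec9823fb.code.sub_mem_expDiffSubgroup_A (by decide) (by decide)) 11)


/-- The two layout generators generate `ℤ_3 × ℤ_12` (explicit multiples giving `x` and `y`). -/
theorem code_layout_closure_eq_top : AddSubgroup.closure ({((0 : Fin 3), (0 : Fin 12)) - (0, 1), ((1 : Fin 3), (0 : Fin 12)) - (2, 0)} : Set (BB.Mono 3 12)) = ⊤ := by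
  apply BB.Code.addSubgroup_eq_top_of_unit_mem
  · have h1 := AddSubgroup.subset_closure (k := ({((0 : Fin 3), (0 : Fin 12)) - (0, 1), ((1 : Fin 3), (0 : Fin 12)) - (2, 0)} : Set (BB.Mono 3 12))) (Set.mem_insert _ _)
    have h2 := AddSubgroup.subset_closure (k := ({((0 : Fin 3), (0 : Fin 12)) - (0, 1), ((1 : Fin 3), (0 : Fin 12)) - (2, 0)} : Set (BB.Mono 3 12))) (Set.mem_insert_of_mem _ rfl)
    have e : (0 : ℕ) • (((0 : Fin 3), (0 : Fin 12)) - (0, 1)) + (2 : ℕ) • (((1 : Fin 3), (0 : Fin 12)) - (2, 0)) = (1, 0) := by decide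
    have h' := AddSubgroup.add_mem _ (AddSubgroup.nsmul_mem _ h1 0) (AddSubgroup.nsmul_mem _ h2 2)
    rw [e] at h'
    exact h'
  · have h1 := AddSubgroup.subset_closure (k := ({((0 : Fin 3), (0 : Fin 12)) - (0, 1), ((1 : Fin 3), (0 : Fin 12)) - (2, 0)} : Set (BB.Mono 3 12))) (Set.mem_insert _ _)
    have h2 := AddSubgroup.subset_closure (k := ({((0 : Fin 3), (0 : Fin 12)) - (0, 1), ((1 : Fin 3), (0 : Fin 12)) - (2, 0)} : Set (BB.Mono 3 12))) (Set.mem_insert_of_mem _ rfl)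
    have e : (11 : ℕ) • (((0 : Fin 3), (0 : Fin 12)) - (0, 1)) + (0 : ℕ) • (((1 : Fin 3), (0 : Fin 12)) - (2, 0)) = (0, 1) := by decide
    have h' := AddSubgroup.add_mem _ (AddSubgroup.nsmul_mem _ h1 11) (AddSubgroup.nsmul_mem _ h2 0)
    rw [e] at h'
    exact h'

set_option maxRecDepth 100000 in
/-- Orders of the two layout generators: `12` and `3`. -/
theorem code_layout_orders : addOrderOf (((0 : Fin 3), (0 : Fin 12)) - (0, 1)) = 12 ∧ addOrderOf (((1 : Fin 3), (0 : Fin 12)) - (2, 0)) = 3 :=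
  ⟨(addOrderOf_eq_iff (by norm_num)).mpr (by decide), (addOrderOf_eq_iff (by norm_num)).mpr (by decide)⟩

/-- **`A1s_n72_k8_ec9823fb.code` has a toric layout with `(μ, λ) = (12, 3)`** (BCGMRY24 Lemma 4). Census layout column, KERNEL. -/
theorem code_hasToricLayoutWith : HasToricLayoutWith 12 3 A1s_n72_k8_ec9823fb.code.css.tannerGraph := by
  have h := A1s_n72_k8_ec9823fb.code.hasToricLayoutWith_of_exponents (g := ((0 : Fin 3), (0 : Fin 12))) (g' := (0, 1))
    (h := ((1 : Fin 3), (0 : Fin 12))) (h' := (2, 0)) (by decide) (by decide) (by decide) (by decide)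
    code_layout_closure_eq_top (by rw [code_layout_orders.1, code_layout_orders.2])
  rwa [code_layout_orders.1, code_layout_orders.2] at h

/-- `A1s_n72_k8_ec9823fb.code` has a toric layout. KERNEL. -/
theorem code_hasToricLayout : HasToricLayout A1s_n72_k8_ec9823fb.code.css.tannerGraph :=
  ⟨12, 3, by norm_num, by norm_num, code_hasToricLayoutWith⟩


set_option maxRecDepth 100000 in
/-- **`A1s_n72_k8_ec9823fb.code`**: Tanner graph = edge-disjoint union of two layers whose components are wheel graphs `prismGraph 6` (`A₃A₂ᵀ` of order
`3`) and `prismGraph 24` (`B₂B₁ᵀ` of order `12`) — BCGMRY24 Lemma 2 minus planarity (`BB.Code.exists_wheel_layers`). KERNEL. -/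
theorem code_wheel_layers :
    ∃ ΓA ΓB : SimpleGraph ((BB.Mono 3 12 ⊕ BB.Mono 3 12) ⊕ (BB.Mono 3 12 ⊕ BB.Mono 3 12)),
    A1s_n72_k8_ec9823fb.code.css.tannerGraph = ΓA ⊔ ΓB ∧ Disjoint ΓA ΓB ∧
    (∀ K : ΓA.ConnectedComponent, Nonempty (K.toSimpleGraph ≃g prismGraph 6)) ∧
    (∀ K : ΓB.ConnectedComponent, Nonempty (K.toSimpleGraph ≃g prismGraph 24)) := by
  have hA : ∀ g : BB.Mono 3 12, A1s_n72_k8_ec9823fb.code.A g ≠ 0 ↔ g = ((0 : Fin 3), (0 : Fin 12)) ∨ g = ((0 : Fin 3), (1 : Fin 12)) ∨ g = ((0 : Fin 3), (5 : Fin 12)) := by decide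
  have hB : ∀ g : BB.Mono 3 12, A1s_n72_k8_ec9823fb.code.B g ≠ 0 ↔ g = ((0 : Fin 3), (9 : Fin 12)) ∨ g = ((1 : Fin 3), (0 : Fin 12)) ∨ g = ((2 : Fin 3), (0 : Fin 12)) := by decide
  have h := A1s_n72_k8_ec9823fb.code.exists_wheel_layers (g₁ := ((0 : Fin 3), (0 : Fin 12))) (g₂ := ((0 : Fin 3), (1 : Fin 12))) (g₃ := ((0 : Fin 3), (5 : Fin 12))) (h₁ := ((0 : Fin 3), (9 : Fin 12)))
    (h₂ := ((1 : Fin 3), (0 : Fin 12))) (h₃ := ((2 : Fin 3), (0 : Fin 12))) (by decide) (by decide) (by decide) (by decide) (by decide) (by decide) hA hB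
  have e1 : addOrderOf (((0 : Fin 3), (5 : Fin 12)) - (0, 1)) = 3 := (addOrderOf_eq_iff (by norm_num)).mpr (by decide)
  have e2 : addOrderOf (((1 : Fin 3), (0 : Fin 12)) - (0, 9)) = 12 := (addOrderOf_eq_iff (by norm_num)).mpr (by decide)
  rw [e1, e2] at h
  exact h

end Summit.Ventures.QEC.Census.A1s_n72_k8_ec9823fb
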